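import Literature.Analysis.SegalBargmann.SchwartzTensorPi
import Literature.Analysis.SegalBargmann.SchwartzBargmannIntertwining
import HarnessLib

/-!
# Separate-variables products through the Bargmann dictionary: `B⁻¹(F ⊗ G) = B⁻¹F ⊠ B⁻¹G`

Topic `Analysis/SegalBargmann`; namespace `Literature.Analysis.SegalBargmann`.  KERNEL MATHEMATICS ONLY (two proved identities,
no records, no proof holes).

`SchwartzTensorPi` proved the separate-variables product rule for the Hermite–Gaussian functions attached to polynomials
(`hermiteFun_rename_mul`) and for the inverse Bargmann transform on polynomials (`binv_rename_mul`); `SchwartzBargmannIntertwining`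
packaged `hermiteFun`/`binv` as Schwartz functions on `ℝ^σ` (`hermiteSchwartzPi`, `binvPi`).  This leaf states the product rule at
the level of those Schwartz functions, in the currency `tensorPi` (`Φ₁ ⊠ Φ₂`) of the two-factor files
(`ArchWeilDatumFactorisation`, `SchwartzTensorSchur`):

* `hermiteSchwartzPi_rename_mul : hermiteSchwartzPi (F(z_inl) · G(z_inr)) = hermiteSchwartzPi F ⊠ hermiteSchwartzPi G`;
* `binvPi_rename_mul : binvPi (F(z_inl) · G(z_inr)) = binvPi F ⊠ binvPi G`.

Use (pub-hodgecm model cell, rows A12/A34): a printed pure tensor of local Fock vectors, inserted as ONE polynomial in the variables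
of all places, is the `⊠`-product of the local Bargmann-inverse vectors — the bridge between the printed insertion (`placeTensorIns`,
`follandFock`) and the block-frame statements `ω′(s u)(Φ₁ ⊠ Φ₂) = …` of the archimedean factorisation.

## References

* [Folland1989] G. B. Folland, *Harmonic Analysis in Phase Space*, Princeton UP (1989), §1.6 (1.63)–(1.68), §1.7 (the Bargmann
  transform is multiplicative on functions of separate variables; Hermite functions of a product index factor).
-/

set_option autoImplicit false

noncomputable section

open MvPolynomial

namespace Literature.Analysis.SegalBargmann

variable {σ₁ σ₂ : Type*} [Fintype σ₁] [Fintype σ₂] [DecidableEq σ₁] [DecidableEq σ₂]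

omit [DecidableEq σ₁] [DecidableEq σ₂] in
/-- **Hermite–Gaussian Schwartz functions are multiplicative on separate variables**:
`hermiteSchwartzPi (F(z_inl) G(z_inr)) = hermiteSchwartzPi F ⊠ hermiteSchwartzPi G`. [cite: Folland1989, §1.7] -/
theorem hermiteSchwartzPi_rename_mul (F : MvPolynomial σ₁ ℂ) (G : MvPolynomial σ₂ ℂ) :
    (hermiteSchwartzPi (rename (Sum.inl : σ₁ → σ₁ ⊕ σ₂) F * rename Sum.inr G) : SchwartzMap (σ₁ ⊕ σ₂ → ℝ) ℂ) =
      tensorPi (hermiteSchwartzPi F) (hermiteSchwartzPi G) := by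
  ext x
  rw [hermiteSchwartzPi_apply, tensorPi_apply, hermiteSchwartzPi_apply, hermiteSchwartzPi_apply, hermiteFun_rename_mul]

/-- **The inverse Bargmann transform is multiplicative on separate variables**, on `𝓢`:
`binvPi (F(z_inl) G(z_inr)) = binvPi F ⊠ binvPi G`. [cite: Folland1989, §1.6 (1.63)–(1.68), §1.7] -/
theorem binvPi_rename_mul (F : MvPolynomial σ₁ ℂ) (G : MvPolynomial σ₂ ℂ) :
    (binvPi (rename (Sum.inl : σ₁ → σ₁ ⊕ σ₂) F * rename Sum.inr G) : SchwartzMap (σ₁ ⊕ σ₂ → ℝ) ℂ) =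
      tensorPi (binvPi F) (binvPi G) := by
  rw [binvPi_def, binvPi_def, binvPi_def, binv_rename_mul, hermiteSchwartzPi_rename_mul]

end Literature.Analysis.SegalBargmann

end
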